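import Summits.BirchSwinnertonDyer.BirchSwinnertonDyer.Theorems.ManinLocalTwoThreeNegOneTwistIstarThreeIIstar
import Summits.BirchSwinnertonDyer.BirchSwinnertonDyer.Theorems.ManinLocalTwoThreeNegOneTwistIstarTwoTen
import Summits.BirchSwinnertonDyer.BirchSwinnertonDyer.Theorems.ManinLocalTwoThreeNegOneTwistIstarZeroEight
import Summits.BirchSwinnertonDyer.BirchSwinnertonDyer.Theorems.ManinLocalTwoThreeConductorExponentFourAtTwo
import HarnessLib

/-!
# S-an-63 «16 ∥ N descends» for `d = −1`: `f₂(W) = 4 ⟹ f₂(W ⊗ (−1)) ≤ 3` (Barrios et al. 2025, Thm. 5.1, Table `localdata-dodd`: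
# no row with `f = 4` keeps `f^d = 4` for `d ≡ 3 (mod 4)`)
# (route `ManinLocalTwoThree`, crux C2 `ManinOddAtFour` stmt-BirchSwinnertonDyer-22967; cell bsd-f2-manin, an's candidate S-an-63; p3 gen 12)

The assembly of the seven `f₂ = 4` rows at `2` over `ℚ` (`kodairaSymbolAt_of_conductorExponent_eq_four_two`): `II/4 → {III, IV}`
(`f ∈ {3, 2}`), `I₀*/8 → {IV*, I₁*}` (`f ∈ {2, 3}`), `I₂*/10 → III*` (`3`), `I₃*/11 → II*` (`3`), `I₄*/12 → I₀` (`0`), `II*/12 → I₀` (`0`),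
`Iₙ*/(n+8) → Iₙ₋₄` (`1`), each kernel-checked by Tate's algorithm over `ℤ₂` in the sibling files.  Consequence: **`16 ∥ N(W) ⟹ 16 ∤ N(W ⊗ (−1))`**
in the exponent form `f₂(W ⊗ (−1)) ≤ 3` (also at any place `v` of `ℤ` with `natGenerator v = 2`).  The `d ≡ 3 (mod 4)` transport and an's
S-an-63L / `SixteenExactDescends` bodies by name are p2's (cell split 2026-08-29T06:52:50Z), on top of this file.
HONEST FRAMING: a local theorem in print, kernel-checked; nothing about BSD or Manin's conjecture is proved; C2 OPEN.
[cite: BarriosEtAl2025, Thm. 5.1 (arXiv:2501.03209 pp. 15–16), Table localdata-dodd, column d ≡ 3 (mod 4)] [cite: SilvermanATAEC1994, IV.9.4 and IV.11.1]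
-/

set_option autoImplicit false
-- lint-debt: the directory name repeats the summit name (sibling precedent `ManinLocalTwoThreeNegOneTwistConductorAtTwo.lean`)
set_option linter.dupNamespace false

noncomputable section

open scoped Classical
open WeierstrassCurve Literature.NumberTheory.DiophantineGeometry

namespace Summit.BirchSwinnertonDyer.BirchSwinnertonDyer.Theorems.ManinLocalTwoThree

/-- **S-an-63 for `d = −1`: `f₂(W) = 4 ⟹ f₂(W ⊗ (−1)) ≤ 3`** — the `χ₋₄`-twist of a curve with `16 ∥ N` has `16 ∤ N`.
[cite: BarriosEtAl2025, Thm. 5.1 (arXiv:2501.03209 pp. 15–16), Table localdata-dodd, column d ≡ 3 (mod 4): (f, f^d) ∈ {(4,0),(4,1),(4,2),(4,3)}] -/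
theorem conductorExponent_quadraticTwist_negOne_le_three_of_eq_four (W : WeierstrassCurve ℚ) [W.IsElliptic]
    (hf : W.conductorExponent ((Rat.HeightOneSpectrum.primesEquiv (R := ℤ)).symm ⟨2, Nat.prime_two⟩) = 4) :
    (W.quadraticTwist ((-1 : ℤ) : ℚ)).conductorExponent ((Rat.HeightOneSpectrum.primesEquiv (R := ℤ)).symm ⟨2, Nat.prime_two⟩) ≤ 3 := by
  have hv : Rat.HeightOneSpectrum.natGenerator ((Rat.HeightOneSpectrum.primesEquiv (R := ℤ)).symm ⟨2, Nat.prime_two⟩) = 2 :=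
    congrArg Subtype.val ((Rat.HeightOneSpectrum.primesEquiv (R := ℤ)).apply_symm_apply ⟨2, Nat.prime_two⟩)
  rcases kodairaSymbolAt_of_conductorExponent_eq_four_two W _ hv hf with
    ⟨hK, hord⟩ | ⟨hK, hord⟩ | ⟨hK, hord⟩ | ⟨hK, hord⟩ | ⟨hK, hord⟩ | ⟨hK, hord⟩ | ⟨n, hK, hord⟩
  · exact conductorExponent_quadraticTwist_negOne_le_three_of_II_four W hK hord
  · exact conductorExponent_quadraticTwist_negOne_le_three_of_IstarZero_eight W hK hord
  · exact (conductorExponent_quadraticTwist_negOne_of_IstarTwo_ten W hK hord).le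
  · exact (conductorExponent_quadraticTwist_negOne_of_IstarThree_eleven W hK hord).le
  · exact (conductorExponent_quadraticTwist_negOne_of_IstarFour_twelve W hK hord).le.trans (by norm_num)
  · exact (conductorExponent_quadraticTwist_negOne_of_IIstar_twelve W hK hord).le.trans (by norm_num)
  · exact (conductorExponent_quadraticTwist_negOne_of_Istar_of_five_le W (n := n + 5) (by omega) hK
      (by rw [hord])).le.trans (by norm_num)

/-- **S-an-63 for `d = −1` at any place `v` of `ℤ` above `2`** (`natGenerator v = 2`). [cite: BarriosEtAl2025, Thm. 5.1, Table localdata-dodd] -/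
theorem conductorExponent_quadraticTwist_negOne_le_three_of_eq_four' (W : WeierstrassCurve ℚ) [W.IsElliptic]
    (v : IsDedekindDomain.HeightOneSpectrum ℤ) (hv : Rat.HeightOneSpectrum.natGenerator v = 2) (hf : W.conductorExponent v = 4) :
    (W.quadraticTwist ((-1 : ℤ) : ℚ)).conductorExponent v ≤ 3 := by
  have hpv : Rat.HeightOneSpectrum.primesEquiv (R := ℤ) v = ⟨2, Nat.prime_two⟩ := Subtype.ext hv
  have hvv : v = (Rat.HeightOneSpectrum.primesEquiv (R := ℤ)).symm ⟨2, Nat.prime_two⟩ := by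
    rw [← hpv, Equiv.symm_apply_apply]
  subst hvv
  exact conductorExponent_quadraticTwist_negOne_le_three_of_eq_four W hf

/-- **S-an-63 for `d = −1`, the `≠ 4` form**: `f₂(W) = 4 ⟹ f₂(W ⊗ (−1)) ≠ 4`. [cite: BarriosEtAl2025, Thm. 5.1, Table localdata-dodd] -/
theorem conductorExponent_quadraticTwist_negOne_ne_four_of_eq_four (W : WeierstrassCurve ℚ) [W.IsElliptic]
    (hf : W.conductorExponent ((Rat.HeightOneSpectrum.primesEquiv (R := ℤ)).symm ⟨2, Nat.prime_two⟩) = 4) :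
    (W.quadraticTwist ((-1 : ℤ) : ℚ)).conductorExponent ((Rat.HeightOneSpectrum.primesEquiv (R := ℤ)).symm ⟨2, Nat.prime_two⟩) ≠ 4 := by
  have := conductorExponent_quadraticTwist_negOne_le_three_of_eq_four W hf
  omega

end Summit.BirchSwinnertonDyer.BirchSwinnertonDyer.Theorems.ManinLocalTwoThree

end
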